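import Mathlib
import Summits.Ventures.PercRepro2.Defs
import Summits.Ventures.PercRepro2.Graph
import Summits.Ventures.PercRepro2.OneColourSwitch
import Summits.Ventures.PercRepro2.RegionHubSign
import Summits.Ventures.PercRepro2.SideSwitch
import Summits.Ventures.PercRepro2.TermSwitchDefs
import Summits.Ventures.PercRepro2.TermSwitchReach
import Summits.Ventures.PercRepro2.M9NoPocketDefs
import Summits.Ventures.PercRepro2.M9Unreached
import Summits.Ventures.PercRepro2.M9GeneralDSplit
import Summits.Ventures.PercRepro2.M9GeneralDHD
import Summits.Ventures.PercRepro2.M9LinkedHD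
import Summits.Ventures.PercRepro2.M9PocketCubeDefs
import Summits.Ventures.PercRepro2.M9PocketCubeWorldMono
import Summits.Ventures.PercRepro2.M9DAvoidSplit
import Summits.Ventures.PercRepro2.M9LinkedGroup
import Summits.Ventures.PercRepro2.M9LinkedGroupLegal
import Summits.Ventures.PercRepro2.M9LinkedGroupAnti
import Summits.Ventures.PercRepro2.M9LinkedGroupTilt2
import Summits.Ventures.PercRepro2.M9LinkedGroupGen

/-!
# The hub–dead-end route to the general single-`d` statement: the `Y`-only / `W`-only split
(blind cell PercRepro2, p3 g30, 2026-08-28; `proofs/P3-HDR.md` §1–§2)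

On the `K`-side hub–dead-end colourings (`HD ∧ d ∈ K₂`) the sign `σ_rs` is `+1` on the
**`Y`-only** points (`r ~_Y s`, `r ≁_W s`), `−1` on the **`W`-only** points and `0` otherwise, so
`hdKSum = Y0 − W0` with `Y0 = Σ_{HD ∧ K ∧ Y-only} σ_pq`, `W0 = Σ_{HD ∧ K ∧ W-only} σ_pq`
(`hdKSum_eq_yOnly_sub_wOnly`).  With the general reduction `dSignSum ≤ hdSum = 2 · hdKSum`
(`M9GeneralDSplit`, `M9LinkedHD`) the single-`d` statement follows from **`Y0 ≤ W0`** on every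
graph (`dSignSum_nonpos_of_yOnly_le_wOnly`) — the census-true real-graph statement of
`proofs/P3-HDR.md` (the hub–dead-end sum is non-positive on real graphs even in the mixed case,
where it is not per pocket representative).  Proved here: **`Y0 ≤ 0`** (`hdKYOnlySum_nonpos`) —
the `Y`-only `K`-side region is antitone on the group intervals of the `Y`-pocket groups
(`r ~_Y s` decreases, `r ~_W s` increases, the `W`-defect decreases), so the general group tilt
`cube_sum_nonpos_of_anti` applies.  Own work; std axioms.
-/

namespace Summit.Ventures.PercRepro2

namespace NoPocket

open Finset Classical RegionHub OneColourSwitch SideSwitch TermSwitch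

variable {V : Type*} {E : Type*}

section Split

variable [Fintype E] [DecidableEq E] {ends : E → Sym2 V} {p q r s d : V}

/-- The `Y`-only `K`-side hub–dead-end colourings: `HD`, `d ∈ K₂`, `r ~_Y s`, `r ≁_W s`. -/
def HDKYOnly (ends : E → Sym2 V) (p q r s d : V) (ω : Config E) : Prop :=
  HD ends p q r s d ω ∧ d ∈ K2 ends r s ω ∧ Conn ends ω r s ∧
    ¬ Conn ends (OneColourSwitch.compl ω) r s

/-- The `W`-only `K`-side hub–dead-end colourings: `HD`, `d ∈ K₂`, `r ~_W s`, `r ≁_Y s`. -/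
def HDKWOnly (ends : E → Sym2 V) (p q r s d : V) (ω : Config E) : Prop :=
  HD ends p q r s d ω ∧ d ∈ K2 ends r s ω ∧ Conn ends (OneColourSwitch.compl ω) r s ∧
    ¬ Conn ends ω r s

/-- `Y0`: the `Y`-only part of the `K`-side hub–dead-end sum, `Σ_{HD ∧ K ∧ Y-only} σ_pq`. -/
noncomputable def hdKYOnlySum (ends : E → Sym2 V) (p q r s d : V) : ℤ :=
  ∑ ω : Config E, if HDKYOnly ends p q r s d ω then sigma ends ω p q else 0

/-- `W0`: the `W`-only part of the `K`-side hub–dead-end sum, `Σ_{HD ∧ K ∧ W-only} σ_pq`. -/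
noncomputable def hdKWOnlySum (ends : E → Sym2 V) (p q r s d : V) : ℤ :=
  ∑ ω : Config E, if HDKWOnly ends p q r s d ω then sigma ends ω p q else 0

omit [Fintype E] [DecidableEq E] in
/-- The pointwise split of `σ_pq · σ_rs` on `HD ∧ d ∈ K₂` into the `Y`-only and `W`-only parts. -/
lemma hdK_term_split (ω : Config E) :
    (if HD ends p q r s d ω ∧ d ∈ K2 ends r s ω then sigma ends ω p q * sigma ends ω r s
      else 0) =
      (if HDKYOnly ends p q r s d ω then sigma ends ω p q else 0) -
      (if HDKWOnly ends p q r s d ω then sigma ends ω p q else 0) := by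
  by_cases h : HD ends p q r s d ω ∧ d ∈ K2 ends r s ω
  · rw [if_pos h]
    by_cases hY : Conn ends ω r s <;> by_cases hW : Conn ends (OneColourSwitch.compl ω) r s
    · have h1 : ¬ HDKYOnly ends p q r s d ω := fun h' => h'.2.2.2 hW
      have h2 : ¬ HDKWOnly ends p q r s d ω := fun h' => h'.2.2.2 hY
      rw [if_neg h1, if_neg h2]
      simp only [sigma, if_pos hY, if_pos hW]
      ring
    · have h1 : HDKYOnly ends p q r s d ω := ⟨h.1, h.2, hY, hW⟩
      have h2 : ¬ HDKWOnly ends p q r s d ω := fun h' => hW h'.2.2.1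
      rw [if_pos h1, if_neg h2]
      simp only [sigma, if_pos hY, if_neg hW]
      ring
    · have h1 : ¬ HDKYOnly ends p q r s d ω := fun h' => hY h'.2.2.1
      have h2 : HDKWOnly ends p q r s d ω := ⟨h.1, h.2, hW, hY⟩
      rw [if_neg h1, if_pos h2]
      simp only [sigma, if_neg hY, if_pos hW]
      ring
    · have h1 : ¬ HDKYOnly ends p q r s d ω := fun h' => hY h'.2.2.1
      have h2 : ¬ HDKWOnly ends p q r s d ω := fun h' => hW h'.2.2.1
      rw [if_neg h1, if_neg h2]
      simp only [sigma, if_neg hY, if_neg hW]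
      ring
  · have h1 : ¬ HDKYOnly ends p q r s d ω := fun h' => h ⟨h'.1, h'.2.1⟩
    have h2 : ¬ HDKWOnly ends p q r s d ω := fun h' => h ⟨h'.1, h'.2.1⟩
    rw [if_neg h, if_neg h1, if_neg h2, sub_zero]

/-- **`hdKSum = Y0 − W0`**: the `K`-side hub–dead-end sum is the `Y`-only sum minus the `W`-only
sum. -/
theorem hdKSum_eq_yOnly_sub_wOnly :
    hdKSum ends p q r s d = hdKYOnlySum ends p q r s d - hdKWOnlySum ends p q r s d := by
  unfold hdKSum hdKYOnlySum hdKWOnlySum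
  rw [← Finset.sum_sub_distrib]
  exact Finset.sum_congr rfl fun ω _ => hdK_term_split ω

/-- **`hdSum = 2 · (Y0 − W0)`.** -/
theorem hdSum_eq_two_mul_yOnly_sub_wOnly :
    hdSum ends p q r s d = 2 * (hdKYOnlySum ends p q r s d - hdKWOnlySum ends p q r s d) := by
  rw [hdSum_eq_two_mul_hdKSum, hdKSum_eq_yOnly_sub_wOnly]

end Split

section Reduction

variable [Fintype V] [DecidableEq V] [Fintype E] [DecidableEq E] {ends : E → Sym2 V}
  {p q r s d : V}

/-- **The general single-`d` statement follows from `Y0 ≤ W0`** (the real-graph hub–dead-end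
inequality of `proofs/P3-HDR.md`). -/
theorem dSignSum_nonpos_of_yOnly_le_wOnly (hrd : r ≠ d) (hsd : s ≠ d)
    (h : hdKYOnlySum ends p q r s d ≤ hdKWOnlySum ends p q r s d) :
    dSignSum ends p q r s d ≤ 0 := by
  have h1 := dSignSum_le_hdSum (ends := ends) (p := p) (q := q) hrd hsd
  rw [hdSum_eq_two_mul_yOnly_sub_wOnly] at h1
  linarith

omit [Fintype V] [DecidableEq V] [Fintype E] [DecidableEq E] in
/-- The `Y`-only `K`-side region implies `Sep ∧ DOne ∧ d ∈ K₂ ∖ M₂`. -/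
lemma hdKYOnly_kside {ω : Config E} (h : HDKYOnly ends p q r s d ω) :
    sep2 ends p q r s ω ∧ DOne ends r s d ω ∧ d ∈ K2 ends r s ω ∧ d ∉ M2 ends r s ω := by
  obtain ⟨hHD, hK, _, _⟩ := h
  obtain ⟨hsep, hD, hone, _⟩ := hd_iff_dzero.1 hHD
  refine ⟨hsep, fun x hxr hxs _ hxK => hD x hxr hxs hxK, hK, ?_⟩
  rcases hone with ⟨_, hM⟩ | ⟨_, hK'⟩
  · exact hM
  · exact absurd hK hK'

/-- **The `Y`-only `K`-side region is antitone on the group intervals** of `Sep`, `K`-side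
points: `r ~_Y s` survives downwards (`conn_rs_assignX_anti'`), `r ≁_W s` survives downwards
(`conn_rs_compl_assignX_mono'`), and the `HD ∧ K ∧ r ~_Y s` part is the down-set of
`M9LinkedGroupAnti`. -/
lemma hdKYOnly_anti (hr : d ≠ r) (hs : d ≠ s) (hpd : p ≠ d) (hqd : q ≠ d) {ρ : Config E}
    (hρ : ρ ∈ RepP ends p q r s d) {x : Finset (Finset V) × Finset E}
    (hx : x ∈ cubeP ends d r s ρ) (hsepx : sep2 ends p q r s (assignX ends x ρ))
    (hKx : d ∈ K2 ends r s (assignX ends x ρ)) {y y' : Finset (Finset V) × Finset E}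
    (hy : y ∈ groupInterval ends d r s ρ x) (hy' : y' ∈ groupInterval ends d r s ρ x)
    (hyy' : y ≤ y') (h : HDKYOnly ends p q r s d (assignX ends y' ρ)) :
    HDKYOnly ends p q r s d (assignX ends y ρ) := by
  obtain ⟨hHD', hK', hY', hW'⟩ := h
  obtain ⟨hHD, hK, hY⟩ := hdKY_anti_of_mem_groupInterval hr hs hpd hqd hρ hx hsepx hKx hy hy'
    hyy' ⟨hHD', hK', hY'⟩
  refine ⟨hHD, hK, hY, fun hc => hW' ?_⟩
  exact conn_rs_compl_assignX_mono' hr hs hρ hyy' (mem_cubeP_of_mem_groupInterval hy)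
    (mem_cubeP_of_mem_groupInterval hy') hc

/-- **`Y0 ≤ 0`**: the `Y`-only part of the `K`-side hub–dead-end sum is non-positive on every
graph (the group tilt on an antitone region). -/
theorem hdKYOnlySum_nonpos (hr : d ≠ r) (hs : d ≠ s) (hpd : p ≠ d) (hqd : q ≠ d) :
    hdKYOnlySum ends p q r s d ≤ 0 := by
  have h1 : hdKYOnlySum ends p q r s d = ∑ ω ∈ DOneSet ends p q r s d,
      (if HDKYOnly ends p q r s d ω then sigma ends ω p q else 0) := by
    unfold hdKYOnlySum DOneSet
    rw [Finset.sum_filter]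
    refine Finset.sum_congr rfl fun ω _ => ?_
    by_cases h : sep2 ends p q r s ω ∧ DOne ends r s d ω
    · simp [h]
    · have h' : ¬ HDKYOnly ends p q r s d ω := fun h' => h ⟨h'.1.1, h'.1.2.1⟩
      simp [h, h']
  rw [h1, sum_dOne_eq_sum_repP_legalP hr hs]
  refine Finset.sum_nonpos fun ρ hρ => ?_
  have h2 : ∑ x ∈ LegalP ends p q r s d ρ,
      (if HDKYOnly ends p q r s d (assignX ends x ρ) then sigma ends (assignX ends x ρ) p q
        else 0) =
      ∑ x ∈ (cubeP ends d r s ρ).filter (fun x => HDKYOnly ends p q r s d (assignX ends x ρ)),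
        sigma ends (assignX ends x ρ) p q := by
    rw [← Finset.sum_filter]
    refine Finset.sum_congr ?_ fun _ _ => rfl
    ext x
    simp only [Finset.mem_filter, mem_LegalP, mem_DOneSet]
    constructor
    · rintro ⟨⟨hc, _⟩, h⟩
      exact ⟨hc, h⟩
    · rintro ⟨hc, h⟩
      exact ⟨⟨hc, h.1.1, h.1.2.1⟩, h⟩
  rw [h2]
  refine le_trans (Finset.sum_le_sum fun x hx => ?_)
    (cube_sum_nonpos_of_anti hr hs hρ (fun _ h => hdKYOnly_kside h)
      (fun x hx hsepx hKx y y' hy hy' hyy' h =>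
        hdKYOnly_anti hr hs hpd hqd hρ hx hsepx hKx hy hy' hyy' h))
  obtain ⟨_, hP⟩ := Finset.mem_filter.1 hx
  obtain ⟨hsep, _, hK, hM⟩ := hdKYOnly_kside hP
  rw [sigma_eq_endsD_add (d := d) hsep, if_pos hK, if_neg hM]
  have := eW_nonneg (ends := ends) (d := d) (p := p) (q := q) (assignX ends x ρ)
  linarith

end Reduction

end NoPocket

end Summit.Ventures.PercRepro2
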